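/-
Copyright: cell `pub-ymgap` (HUMAN RULING D-0062), Track A of `YM-PLAN.md`, DAG node N20 (= NE7b); R134 acceleration seat
`pub-ymgap-dag-n20-c` (strategy s1, generation 5), module 27.  Released under the licence of the surrounding project.
-/
import Literature.MathematicalPhysics.QuantumFieldTheory.Balaban1983to89.Node00.StepWeightsOfRecord
import Literature.MathematicalPhysics.QuantumFieldTheory.Balaban1983to89.Node00.DatumAvLayer
import Summits.QuantumFields.BalabanUV.T4Continuum.Spine.NE7b.StepKernelOps
import Summits.QuantumFields.BalabanUV.T4Continuum.Spine.NE7b.StepKernelOfMap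
import Summits.QuantumFields.BalabanUV.T4Continuum.Support.ShellMeasureAverageIterate
import HarnessLib

/-!
# YM-DAG node N20 (= NE7b), strategy s1, module 27: THE LABEL TOWER OF RECORD — Bałaban's T-steps with the (3.2)·(3.3)·(3.16)·(3.20)
# label weights of `Node00.StepWeightsOfRecord` AS ONE CONCRETE `B16HistoryReprChain.Tower` over the good classes `bddMeas`, in the
# CONDITIONAL-EXPECTATION CURRENCY (level measures = the laws of the iterated block averages of the Haar field), with the (α)-road's
# tower rows `hstep` ∕ `hint` ∕ `hintχ` ∕ `hint′` ∕ `hρ₀` PROVED for it — no density letter, no `HaarAC`, no truncation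

Track A of `YM-PLAN.md` (cell `pub-ymgap`, HUMAN RULING D-0062), node **N20** = spine estimate NE7b (`T4WeightBudget.RelWeightBound` — NOT PRINTED,
NOT PROVED).  Seat `pub-ymgap-dag-n20-c` (R134, s1 «the `LocCondStability` INSTANCE for Bałaban's tower at a pinned 𝐑𝐓 step»), generation 5, module 27
(g4's modules 17–26 = `…N20LCSLargeField*`, `…N20LCSLabelPieces`).  Definition lane: bookkeeping `def`s of ONE object assembled from tree records
(`Node00.StepWeightsOfRecord`, `Node00.DatumAvLayer`, `T4AveragingDisintegration.condLaw`, gaps-ne6's `StepKernelOps.ofKernel`) + kernel theorems;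
0 `sorry`, standard axioms; no `instance`, no notation; COUNT-NEUTRAL; `--supports` the K3‴ item.  Nothing of Bałaban's is asserted.

WHY.  Modules 20 ∕ 23 ∕ 24 ∕ 25 inhabit the (α)-road's two named `Prop`s (`LocalConditionalStability.PointwiseExtraction ∧ LocCondStability`) and fire
its class weight bound `sum_admS_integral_le_of_LCS` AT THE RECORD's step weights — but over an ABSTRACT history tower `T`, modulo the road's displayed
TOWER ROWS `hread` ∕ `hstep` ∕ `hintχ` ∕ `hint` ∕ `hρ₀` (g4 HANDOFF §4: «the tower OBJECT with `RelLinPosHom` ops is the planners' ∕ (A1c)'s»; OPEN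
DESIGN POINT: with Haar measure at every level the T-step `f ↦ avgDensity·∫ f dκ` does NOT map `bddMeas` to `bddMeas` — the Radon–Nikodym marginal
density is pinned a.e. only and not bounded in the tree; gaps-ne6's repair is a truncation under the letter `dU.map avg ≤ C • dV`).  THIS FILE BUILDS
THE OBJECT with a design that needs NO letter: take as LEVEL MEASURES the laws `μ_j` of the `j`-fold block averages `avg_{j−1} ∘ ⋯ ∘ avg_0` of the
Haar-distributed bare field (`lawOfRecord`; `μ_0 =` Haar, `μ_{j+1} = μ_j.map avg_j`), and as the ONE-STEP OPERATION of the label `t` after the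
history `h` the CONDITIONAL-EXPECTATION kernel `condLaw μ_j avg_j` («the law of `U` given `Ū = V′`», MARKOV) twisted by the `[0,1]`-valued label weight
`ω (sq j h) t (U, V′)` (`Kernel.withDensity`) — a FINITE kernel, so `StepKernelOps.ofKernel` makes it a `RelLinPosHom (bddMeas _) (bddMeas _)`
UNCONDITIONALLY.  Its history terms are Bałaban's value-level T-step label pieces ((†) of `Node00.TStepOfRecord`, kernel `transportK`) DIVIDED BY
the total marginal density `dμ_j ∕ dHaar_j` (level 1: literally `avgDensity · eterm = label piece`; higher levels: Bayes), so every integral of a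
history term against an observable of the new field is the same number in both currencies and every RELATIVE display of the road
(`LocCondStability`, `hrel`, `ExtractionLaws`: ratios of such integrals) is unchanged.  The weight is CLAMPED to `[0,1]` in the definition
(`clampW`) so that no law of the residual `ζ` is needed to DEFINE the tower; under `IsZetaUnity ∧ IsZetaAbsLeOne` the clamp is the identity
(`0 ≤ ω ≤ 1`, n21-d + module 21) — module 28.

WHAT.
* §1 (generic: fine level `β` standard Borel with a finite measure `ν`, coarse level `α`, measurable `avg : β → α`, joint weight `w : β → α → ℝ`):
  `clampW`; **`wCondKernel ν avg w := Kernel.withDensity (condLaw ν avg) (clampW ∘ w)`**; `wCondKernel_isFiniteKernel` (mass ≤ 1, unconditionally);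
  `integral_wCondKernel` (`∫ f d(κ_w V′) = ∫ clampW (w U V′)·f U condLaw(V′, dU)`); ★ **`wCondKernel_comp_map`** — THE ONE MEASURE IDENTITY
  `κ_w ∘ₘ ν.map avg = (clampW (w U (avg U)))·ν` (`fst_compProd_condLaw`: the conditional kernel composed with the image measure is the joint law on
  the graph); ★ `integral_ofKernel_wCondKernel` = gaps-ne6's `hstep_of_comp_eq` for it: `∫ (ofKernel κ_w).T f d(ν.map avg) = ∫ clampW (w U Ū)·f U dν`
  for every bounded measurable `f`.
* §2 (of record, `G = SU(N)`, torus `F.P K`, Bałaban's averaging `Node00.avOfRecord`): the `j`-fold average = the tree's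
  `ShellMeasureAverageIterate.iterMap` at `avOfRecord` (`measurable_iterMap_avOfRecord`), **`lawOfRecord K j := (fieldMeasure 0).map (iterMap avg j)`** (`lawOfRecord_zero = fieldMeasure 0`, `lawOfRecord_succ = (lawOfRecord j).map avg_j`,
  a probability measure); the label choice type `LabelPat := Σ k, LbOfRecord F ν p g k` with `labelAt` (`labelAt_mk`), the history's old sequence
  `seqOfHist` (iterate of `Node00.σOfRecord` from `Seq.zero`); **`labelKernel`**, **`labelOp := ofKernel labelKernel`**, ★★★ **`labelTowerOfRecord A₁ ζ :
  Tower LabelPat (cfgOfRecord F N p.K) (fun j => bddMeas _)`** (`branch j h =` all level-`j` labels; `op j h q = labelOp (seqOfHist j h) (labelAt j q)`);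
  the step kernel in the `hstep` currency `labelChi j h q U := clampW (ω (seqOfHist j h) (labelAt j q) U Ū)`; the pattern of a label family
  `labelPattern E j h := (E j h).map (Sigma.mk j)` with `branch_inter_labelPattern`, `sum_labelPattern`.
* §3 THE ROAD's TOWER ROWS FOR THIS TOWER, modulo ONLY the displayed (O4) joint measurability of the label weights (`hω`, as in modules 18–26; def-R's
  (2.12) minimiser has no measurable selection in the tree): `op_apply` (rfl), ★★ **`hstep_labelTower`** (`∫ (op j h q).T f dμ_{j+1} = ∫ labelChi j h q·f dμ_j`
  for every bounded measurable `f` — IR-102-1's `hstep`, `B16HistoryTowerExtractionStepDataLWR.hstep`'s shape), `labelChi_good`, `labelChi_nonneg`,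
  `labelChi_le_one`, `rhoZeroOfRecord_good` (`hρ₀`: `ρ₀ ∈ bddMeas`), `integrable_eterm` (`hint`), `integrable_labelChi_mul_eterm` (`hintχ`),
  `integrable_op_eterm` (`hint′`) — every history term of a bounded measurable `ρ₀` is bounded measurable, every level measure finite.

HONEST FRAMING.  An OBJECT (T-steps of record with label-indexed choices, g4's DESIGN INPUT l.≈16100) and its bookkeeping rows; the 𝐑-step of
[Balaban1989LargeFieldI] (0.3) (def-R's `rstepSlotOfRecord`, the (A1c) object) is NOT in this tower — its levels are pure averaging steps with the
[Balaban1988Convergent] §3 decompositions of unity; which READING of regions ∕ keys off these labels the road's `StepReading` takes is the planners'.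
Displayed, not asserted: the (O4) measurability `hω`; the ζ-laws enter only module 28 (clamp removal, `hunit`).  The currency is RELATIVE (densities
w.r.t. `lawOfRecord`, not Haar) — said again: same integrals, same relative displays; an `H2A`-type identity against Haar at level 0 holds by
`lawOfRecord_zero`.  NE7b NOT PRINTED ∕ NOT PROVED; (α)-instance 0∕1; N20 NOT discharged; typed 28∕28, discharged count untouched; one finite four-torus
at fixed `ε` — NOT ℝ⁴, NOT infinite volume, NOT OS, NOT a mass gap, NOT Clay.

References (LOCATORS; the cited objects carry their own tags in `Node00.*`): T. Bałaban, CMP 119 (1988) 243–285 [Balaban1988Convergent] ((3.1) p. 264,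
(3.2)–(3.5) p. 265, (3.16) p. 268, (3.20)–(3.25) pp. 269–270); CMP 122 (1989) 175–202 [Balaban1989LargeFieldI] ((0.3)–(0.4) p. 176, (1.22)–(1.28)
pp. 181–183); CMP 109 (1987) 249–301 [Balaban1987RG1] ((0.4) p. 253).
-/

set_option autoImplicit false

noncomputable section

open scoped BigOperators ENNReal

namespace Summit.QuantumFields.YangMills.BalabanUVNodes.N20LCSLabelTower

open MeasureTheory ProbabilityTheory
open Literature.MathematicalPhysics.QuantumFieldTheory.Balaban1983to89
open Literature.MathematicalPhysics.QuantumFieldTheory.Balaban1983to89.T4Continuum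
open Literature.MathematicalPhysics.QuantumFieldTheory.Balaban1983to89.T4AveragingDisintegration
  (condLaw jointLaw jointLaw_fst fst_compProd_condLaw measurable_graphMap)
open Literature.MathematicalPhysics.QuantumFieldTheory.Balaban1983to89.B14.Eq218Concrete
open Literature.MathematicalPhysics.QuantumFieldTheory.Balaban1983to89.Node00
open Summit.QuantumFields.BalabanUV.T4Continuum.B16HistoryIndexedRepr (GoodClass)
open Summit.QuantumFields.BalabanUV.T4Continuum.B16HistoryReprChain
open Summit.QuantumFields.BalabanUV.T4Continuum.Spine.NE7b.StepKernelOps (ofKernel ofKernel_apply hstep_of_comp_eq)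
open Summit.QuantumFields.BalabanUV.T4Continuum.ShellMeasureAverageIterate (iterMap)

/-! ## §1 GENERIC: the conditional-expectation kernel of a measurable map twisted by a clamped joint weight -/

section Generic

/-- The clamp to the unit interval, `clampW x = max 0 (min 1 x)`. [folklore] -/
def clampW (x : ℝ) : ℝ := max 0 (min 1 x)

/-- `0 ≤ clampW x`. [folklore] -/
theorem clampW_nonneg (x : ℝ) : 0 ≤ clampW x := le_max_left _ _

/-- `clampW x ≤ 1`. [folklore] -/
theorem clampW_le_one (x : ℝ) : clampW x ≤ 1 := max_le zero_le_one (min_le_left _ _)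

/-- `|clampW x| ≤ 1`. [folklore] -/
theorem abs_clampW_le_one (x : ℝ) : |clampW x| ≤ 1 := by
  rw [abs_of_nonneg (clampW_nonneg x)]; exact clampW_le_one x

/-- On `[0, 1]` the clamp is the identity. [folklore] -/
theorem clampW_eq_self {x : ℝ} (h0 : 0 ≤ x) (h1 : x ≤ 1) : clampW x = x := by
  rw [clampW, min_eq_right h1, max_eq_right h0]

/-- The clamp is measurable (it is continuous). [folklore] -/
theorem measurable_clampW : Measurable clampW :=
  (continuous_const.max (continuous_const.min continuous_id)).measurable

variable {α β : Type} [MeasurableSpace α] [MeasurableSpace β] [StandardBorelSpace β] [Nonempty β]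
  (ν : Measure β) [IsFiniteMeasure ν] (avg : β → α) (w : β → α → ℝ)

/-- **THE WEIGHTED CONDITIONAL KERNEL** of the map `avg` under the finite measure `ν` of the fine level, with the joint weight `w (fine, coarse)`
clamped to `[0,1]`: `κ_w(V′, dU) = clampW (w U V′) · condLaw ν avg (V′, dU)` — the conditional law of `U` given `avg U = V′` twisted by the weight
(`Kernel.withDensity`; the zero kernel if the clamped weight is not jointly measurable). [folklore] -/
def wCondKernel : Kernel α β :=
  Kernel.withDensity (condLaw ν avg) fun a b => ENNReal.ofReal (clampW (w b a))

/-- The weighted conditional kernel is FINITE, unconditionally (a Markov kernel twisted by a density at most one). [folklore] -/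
theorem wCondKernel_isFiniteKernel : IsFiniteKernel (wCondKernel ν avg w) :=
  Kernel.isFiniteKernel_withDensity_of_bounded _ ENNReal.one_ne_top fun a b => ENNReal.ofReal_le_one.2 (clampW_le_one (w b a))

variable {ν avg w}

omit [StandardBorelSpace β] [Nonempty β] in
/-- The density of the weighted conditional kernel is jointly measurable when the weight is. [folklore] -/
theorem measurable_density (hw : Measurable fun z : α × β => w z.2 z.1) :
    Measurable (Function.uncurry fun (a : α) (b : β) => ENNReal.ofReal (clampW (w b a))) :=
  ENNReal.measurable_ofReal.comp (measurable_clampW.comp hw)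

/-- Fibre integrals of the weighted conditional kernel: `∫ f d(κ_w V′) = ∫ clampW (w U V′)·f U condLaw(V′, dU)`. [folklore] -/
theorem integral_wCondKernel (hw : Measurable fun z : α × β => w z.2 z.1) (f : β → ℝ) (a : α) :
    ∫ b, f b ∂(wCondKernel ν avg w a) = ∫ b, clampW (w b a) * f b ∂(condLaw ν avg a) := by
  have hg : Measurable (Function.uncurry fun (a : α) (b : β) => (clampW (w b a)).toNNReal) :=
    (measurable_clampW.comp hw).real_toNNReal
  have e : (fun (a : α) (b : β) => ENNReal.ofReal (clampW (w b a))) = fun a b => ((clampW (w b a)).toNNReal : ℝ≥0∞) := rfl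
  rw [wCondKernel, e, Kernel.integral_withDensity hg]
  refine integral_congr_ae (ae_of_all _ fun b => ?_)
  show ((clampW (w b a)).toNNReal : NNReal) • f b = clampW (w b a) * f b
  rw [NNReal.smul_def, smul_eq_mul, Real.coe_toNNReal _ (clampW_nonneg _)]

/-- ★ **THE ONE MEASURE IDENTITY OF THE WEIGHTED CONDITIONAL KERNEL**: composed with the image measure `ν.map avg` of the coarse level it returns the
fine-level measure with density the weight READ ON THE GRAPH, `κ_w ∘ₘ ν.map avg = (clampW (w U (avg U)))·ν` — the disintegration
`(ν.map avg) ⊗ condLaw = jointLaw` (`fst_compProd_condLaw`) integrated against `𝟙_s(U)·clampW (w U V′)`. [folklore] -/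
theorem wCondKernel_comp_map (havg : Measurable avg) (hw : Measurable fun z : α × β => w z.2 z.1) :
    wCondKernel ν avg w ∘ₘ ν.map avg = ν.withDensity fun b => ENNReal.ofReal (clampW (w b (avg b))) := by
  have hd := measurable_density hw
  ext s hs
  let Gs : α × β → ℝ≥0∞ := (Prod.snd ⁻¹' s).indicator fun z => ENNReal.ofReal (clampW (w z.2 z.1))
  have hGs : Measurable Gs := hd.indicator (measurable_snd hs)
  have e1 : ∀ a, wCondKernel ν avg w a s = ∫⁻ b, Gs (a, b) ∂(condLaw ν avg a) := fun a => by
    rw [wCondKernel, Kernel.withDensity_apply' _ hd, ← lintegral_indicator hs]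
    refine lintegral_congr fun b => ?_
    by_cases hb : b ∈ s
    · simp [Gs, Set.indicator_of_mem hb, Set.indicator_of_mem (show (a, b) ∈ Prod.snd ⁻¹' s from hb)]
    · simp [Gs, Set.indicator_of_notMem hb, Set.indicator_of_notMem (show (a, b) ∉ Prod.snd ⁻¹' s from hb)]
  rw [Measure.bind_apply hs (Kernel.aemeasurable _)]
  simp_rw [e1]
  rw [← Measure.lintegral_compProd hGs, ← jointLaw_fst ν havg, fst_compProd_condLaw ν avg, jointLaw,
    lintegral_map hGs (measurable_graphMap havg), withDensity_apply _ hs, ← lintegral_indicator hs]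
  refine lintegral_congr fun b => ?_
  by_cases hb : b ∈ s
  · simp [Gs, Set.indicator_of_mem hb, Set.indicator_of_mem (show (avg b, b) ∈ Prod.snd ⁻¹' s from hb)]
  · simp [Gs, Set.indicator_of_notMem hb, Set.indicator_of_notMem (show (avg b, b) ∉ Prod.snd ⁻¹' s from hb)]

/-- ★ **`hstep` FOR THE WEIGHTED CONDITIONAL KERNEL** (gaps-ne6's `StepKernelOps.hstep_of_comp_eq` at the identity `wCondKernel_comp_map`): for every
bounded measurable `f` of the fine level, `∫ (ofKernel κ_w).T f d(ν.map avg) = ∫ clampW (w U (avg U))·f U dν`. [folklore] -/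
theorem integral_ofKernel_wCondKernel (havg : Measurable avg) (hw : Measurable fun z : α × β => w z.2 z.1) {f : β → ℝ}
    (hf : (bddMeas β).Gd f) :
    ∫ a, (@ofKernel β α _ _ (wCondKernel ν avg w) (wCondKernel_isFiniteKernel ν avg w)).T f a ∂(ν.map avg) =
      ∫ b, clampW (w b (avg b)) * f b ∂ν := by
  haveI := wCondKernel_isFiniteKernel ν avg w
  exact hstep_of_comp_eq (wCondKernel ν avg w) ν (ν.map avg) (measurable_clampW.comp (hw.comp (measurable_graphMap havg)))
    (fun b => clampW_nonneg _) (wCondKernel_comp_map havg hw) hf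

end Generic

/-! ## §2 OF RECORD: the laws of the iterated block averages, the label choices, the label kernels, THE LABEL TOWER -/

section Record

variable (F : T4Family) (N : ℕ) [NeZero N]

/-- The `j`-fold block average of record `avg_{j−1} ∘ ⋯ ∘ avg_0 : 𝔘_0 → 𝔘_j` on the torus `F.P K` — the tree's iterated level map
`ShellMeasureAverageIterate.iterMap` at `Node00.avOfRecord` — is measurable. [folklore] -/
theorem measurable_iterMap_avOfRecord (K : ℕ) : ∀ j, Measurable (iterMap (fun j => (avOfRecord F N K j).avg) j)
  | 0 => measurable_id
  | j + 1 => (avOfRecord_measurable F N K j).comp (measurable_iterMap_avOfRecord K j)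

/-- **THE LEVEL MEASURES OF THE LABEL TOWER**: `lawOfRecord K j` = the law of the `j`-fold block average of the Haar-distributed level-`0` field (the
free block-spin law at level `j`).  Reducible, so that its finiteness is found by instance search. [folklore] -/
abbrev lawOfRecord (K j : ℕ) : Measure (cfgOfRecord F N K j) :=
  (fieldMeasure (F.P K) 0 (SU N)).map (iterMap (fun j => (avOfRecord F N K j).avg) j)

/-- At level `0` the level measure IS the Haar product measure. [folklore] -/
theorem lawOfRecord_zero (K : ℕ) : lawOfRecord F N K 0 = fieldMeasure (F.P K) 0 (SU N) := Measure.map_id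

/-- One level up the level measure is the image of the previous one under the averaging of record: `μ_{j+1} = μ_j.map avg_j`. [folklore] -/
theorem lawOfRecord_succ (K j : ℕ) : lawOfRecord F N K (j + 1) = (lawOfRecord F N K j).map (avOfRecord F N K j).avg := by
  rw [lawOfRecord, lawOfRecord, Measure.map_map (avOfRecord_measurable F N K j) (measurable_iterMap_avOfRecord F N K j)]
  rfl

/-- Every level measure is a probability measure. [folklore] -/
theorem isProbabilityMeasure_lawOfRecord (K j : ℕ) : IsProbabilityMeasure (lawOfRecord F N K j) :=
  Measure.isProbabilityMeasure_map (measurable_iterMap_avOfRecord F N K j).aemeasurable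

variable (ν : Stage7Numerics) (M : ℕ) (p : B12.RunParams) (g : ℕ → ℝ)

/-- **THE CHOICE TYPE OF THE LABEL TOWER**: a label of SOME level, `Σ k, LbOfRecord F ν p g k` (print's `t = (P,Q,R,S)_{k+1}` of [Balaban1988Convergent]
(3.2)·(3.3)·(3.16)·(3.20), one finite type per level, made into one type). [folklore] -/
abbrev LabelPat : Type := Σ k, LbOfRecord F ν p g k

/-- Reading a choice as a level-`j` label (the empty label if it belongs to another level — never used on a branch). [folklore] -/
def labelAt (j : ℕ) (q : LabelPat F ν p g) : LbOfRecord F ν p g j :=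
  if h : q.1 = j then h ▸ q.2 else (∅, ∅, (∅, ∅))

/-- A level-`j` label read at level `j` is itself. [folklore] -/
@[simp] theorem labelAt_mk (j : ℕ) (t : LbOfRecord F ν p g j) : labelAt F ν p g j ⟨j, t⟩ = t := by
  simp [labelAt]

/-- **THE OLD SEQUENCE OF A HISTORY**: the (2.1)-chain `(Ω_1,…,Ω_j; Λ_1,…,Λ_j)` reached after the label history `h` — the index map of record
`Node00.σOfRecord` iterated from the empty chain `Seq.zero`. [folklore] -/
def seqOfHist : (j : ℕ) → (Fin j → LabelPat F ν p g) → SeqOfRecord F ν M g p.K j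
  | 0, _ => Seq.zero (DOfRecord F ν M g p.K)
  | j + 1, h => σOfRecord F ν M p g j (seqOfHist j (Fin.init h)) (labelAt F ν p g j (h (Fin.last j)))

/-- At level `0` the old sequence is the empty chain. [folklore] -/
theorem seqOfHist_zero (h : Fin 0 → LabelPat F ν p g) : seqOfHist F ν M p g 0 h = Seq.zero (DOfRecord F ν M g p.K) := rfl

/-- One step up: the old sequence of `h` is the index map of record applied to the old sequence of its initial segment and its last label. [folklore] -/
theorem seqOfHist_succ (j : ℕ) (h : Fin (j + 1) → LabelPat F ν p g) :
    seqOfHist F ν M p g (j + 1) h = σOfRecord F ν M p g j (seqOfHist F ν M p g j (Fin.init h)) (labelAt F ν p g j (h (Fin.last j))) := rfl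

variable (A₁ : ℝ) (ζ : ZetaOfRecord F N ν M)

/-- **THE LABEL KERNEL** of the label `t` after the old sequence `s` at level `j`: the conditional law of the level-`j` field `U` given its block average
`Ū = V′` under the level-`j` law of record, twisted by the clamped label weight `ω s t (U, V′)` of `Node00.StepWeightsOfRecord`. [folklore] -/
def labelKernel (j : ℕ) (s : SeqOfRecord F ν M g p.K j) (t : LbOfRecord F ν p g j) :
    Kernel (cfgOfRecord F N p.K (j + 1)) (cfgOfRecord F N p.K j) :=
  wCondKernel (lawOfRecord F N p.K j) (avOfRecord F N p.K j).avg (ωOfRecord F N ν M p g j A₁ ζ s t)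

/-- The label kernel is finite, unconditionally. [folklore] -/
theorem labelKernel_isFiniteKernel (j : ℕ) (s : SeqOfRecord F ν M g p.K j) (t : LbOfRecord F ν p g j) :
    IsFiniteKernel (labelKernel F N ν M p g A₁ ζ j s t) :=
  wCondKernel_isFiniteKernel _ _ _

/-- **THE LABEL OPERATION** = gaps-ne6's kernel step of the label kernel: a positive additive map from the bounded measurable functions of level `j` to
those of level `j + 1` (`StepKernelOps.ofKernel`). [folklore] -/
def labelOp (j : ℕ) (s : SeqOfRecord F ν M g p.K j) (t : LbOfRecord F ν p g j) :
    RelLinPosHom (bddMeas (cfgOfRecord F N p.K j)) (bddMeas (cfgOfRecord F N p.K (j + 1))) :=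
  @ofKernel (cfgOfRecord F N p.K j) (cfgOfRecord F N p.K (j + 1)) _ _ (labelKernel F N ν M p g A₁ ζ j s t)
    (labelKernel_isFiniteKernel F N ν M p g A₁ ζ j s t)

/-- ★★★ **THE LABEL TOWER OF RECORD**: after every history the admissible next choices are ALL labels of the current level, and the operation of the
label `q` after the history `h` at level `j` is the label operation of `q` read at level `j` after the old sequence of `h` — Bałaban's T-step (3.1) with
the decompositions of unity (3.2)·(3.3)·(3.16)·(3.20) inserted, one positive additive map per (history, label), in the conditional-expectation currency.
[folklore] -/
def labelTowerOfRecord : Tower (LabelPat F ν p g) (cfgOfRecord F N p.K) (fun j => bddMeas (cfgOfRecord F N p.K j)) where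
  branch j _ := (Finset.univ : Finset (LbOfRecord F ν p g j)).map ⟨Sigma.mk j, sigma_mk_injective⟩
  op j h q := labelOp F N ν M p g A₁ ζ j (seqOfHist F ν M p g j h) (labelAt F ν p g j q)

/-- **THE STEP KERNEL OF THE LABEL TOWER** in the `hstep` currency: the clamped label weight read on the graph `V′ = Ū`. [folklore] -/
def labelChi (j : ℕ) (h : Fin j → LabelPat F ν p g) (q : LabelPat F ν p g) : cfgOfRecord F N p.K j → ℝ :=
  fun U => clampW (ωOfRecord F N ν M p g j A₁ ζ (seqOfHist F ν M p g j h) (labelAt F ν p g j q) U ((avOfRecord F N p.K j).avg U))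

/-- **THE PATTERN OF A LABEL FAMILY**: the level-`j` labels `E j h` as choices. [folklore] -/
def labelPattern (E : (j : ℕ) → (Fin j → LabelPat F ν p g) → Finset (LbOfRecord F ν p g j)) (j : ℕ) (h : Fin j → LabelPat F ν p g) :
    Finset (LabelPat F ν p g) :=
  (E j h).map ⟨Sigma.mk j, sigma_mk_injective⟩

/-- The branch after `h` at level `j` is the image of all level-`j` labels. [folklore] -/
theorem branch_eq (j : ℕ) (h : Fin j → LabelPat F ν p g) :
    (labelTowerOfRecord F N ν M p g A₁ ζ).branch j h = (Finset.univ : Finset (LbOfRecord F ν p g j)).map ⟨Sigma.mk j, sigma_mk_injective⟩ := rfl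

/-- The pattern of a label family lies on the branch, so `branch ∩ pattern = pattern`. [folklore] -/
theorem branch_inter_labelPattern [DecidableEq (LabelPat F ν p g)]
    (E : (j : ℕ) → (Fin j → LabelPat F ν p g) → Finset (LbOfRecord F ν p g j)) (j : ℕ) (h : Fin j → LabelPat F ν p g) :
    (labelTowerOfRecord F N ν M p g A₁ ζ).branch j h ∩ labelPattern F ν p g E j h = labelPattern F ν p g E j h := by
  refine Finset.inter_eq_right.2 fun q hq => ?_
  obtain ⟨t, _, rfl⟩ := Finset.mem_map.1 hq
  exact Finset.mem_map.2 ⟨t, Finset.mem_univ _, rfl⟩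

/-- Sums over the pattern of a label family are sums over the family. [folklore] -/
theorem sum_labelPattern (E : (j : ℕ) → (Fin j → LabelPat F ν p g) → Finset (LbOfRecord F ν p g j)) (j : ℕ) (h : Fin j → LabelPat F ν p g)
    (φ : LabelPat F ν p g → ℝ) : ∑ q ∈ labelPattern F ν p g E j h, φ q = ∑ t ∈ E j h, φ ⟨j, t⟩ :=
  Finset.sum_map _ _ _

/-- Sums over the branch are sums over all labels of the level. [folklore] -/
theorem sum_branch (j : ℕ) (h : Fin j → LabelPat F ν p g) (φ : LabelPat F ν p g → ℝ) :
    ∑ q ∈ (labelTowerOfRecord F N ν M p g A₁ ζ).branch j h, φ q = ∑ t : LbOfRecord F ν p g j, φ ⟨j, t⟩ :=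
  Finset.sum_map _ _ _

/-! ## §3 The road's tower rows for the label tower, modulo the (O4) measurability of the label weights only -/

/-- The operation of the label tower is the fibre integral of the label kernel (`rfl`). [folklore] -/
theorem op_apply (j : ℕ) (h : Fin j → LabelPat F ν p g) (q : LabelPat F ν p g) (f : cfgOfRecord F N p.K j → ℝ)
    (V' : cfgOfRecord F N p.K (j + 1)) :
    ((labelTowerOfRecord F N ν M p g A₁ ζ).op j h q).T f V' =
      ∫ U, f U ∂(labelKernel F N ν M p g A₁ ζ j (seqOfHist F ν M p g j h) (labelAt F ν p g j q) V') := rfl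

variable {A₁ ζ}

/-- Under the displayed (O4) joint measurability of the label weights, the operation is the conditional expectation of `clampW ω · f` given the block
average: `(op j h q).T f V′ = ∫ clampW (ω s t (U,V′))·f U condLaw(V′, dU)`. [folklore] -/
theorem op_apply_eq_integral_condLaw
    (hω : ∀ (k : ℕ) (s : SeqOfRecord F ν M g p.K k) (t : LbOfRecord F ν p g k),
      Measurable fun z : cfgOfRecord F N p.K (k + 1) × cfgOfRecord F N p.K k => ωOfRecord F N ν M p g k A₁ ζ s t z.2 z.1)
    (j : ℕ) (h : Fin j → LabelPat F ν p g) (q : LabelPat F ν p g) (f : cfgOfRecord F N p.K j → ℝ) (V' : cfgOfRecord F N p.K (j + 1)) :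
    ((labelTowerOfRecord F N ν M p g A₁ ζ).op j h q).T f V' =
      ∫ U, clampW (ωOfRecord F N ν M p g j A₁ ζ (seqOfHist F ν M p g j h) (labelAt F ν p g j q) U V') * f U
        ∂(condLaw (lawOfRecord F N p.K j) (avOfRecord F N p.K j).avg V') := by
  rw [op_apply]
  exact integral_wCondKernel (hω j _ _) f V'

/-- ★★ **`hstep` FOR THE LABEL TOWER OF RECORD** (IR-102-1's per-(step, choice) integral identity, the shape of `B16HistoryTowerExtractionStepDataLWR.hstep`
and of modules 22–25's `hstep` binder): modulo the (O4) measurability of the label weights, for EVERY level `j`, history `h`, choice `q` and bounded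
measurable `f`, `∫ (op j h q).T f dμ_{j+1} = ∫ labelChi j h q · f dμ_j`. [folklore] -/
theorem hstep_labelTower
    (hω : ∀ (k : ℕ) (s : SeqOfRecord F ν M g p.K k) (t : LbOfRecord F ν p g k),
      Measurable fun z : cfgOfRecord F N p.K (k + 1) × cfgOfRecord F N p.K k => ωOfRecord F N ν M p g k A₁ ζ s t z.2 z.1)
    (j : ℕ) (h : Fin j → LabelPat F ν p g) (q : LabelPat F ν p g) (f : cfgOfRecord F N p.K j → ℝ)
    (hf : (bddMeas (cfgOfRecord F N p.K j)).Gd f) :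
    ∫ V', ((labelTowerOfRecord F N ν M p g A₁ ζ).op j h q).T f V' ∂(lawOfRecord F N p.K (j + 1)) =
      ∫ U, labelChi F N ν M p g A₁ ζ j h q U * f U ∂(lawOfRecord F N p.K j) := by
  rw [lawOfRecord_succ]
  exact integral_ofKernel_wCondKernel (avOfRecord_measurable F N p.K j) (hω j _ _) hf

/-- The step kernel is non-negative. [folklore] -/
theorem labelChi_nonneg (j : ℕ) (h : Fin j → LabelPat F ν p g) (q : LabelPat F ν p g) (U : cfgOfRecord F N p.K j) :
    0 ≤ labelChi F N ν M p g A₁ ζ j h q U := clampW_nonneg _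

/-- The step kernel is at most one. [folklore] -/
theorem labelChi_le_one (j : ℕ) (h : Fin j → LabelPat F ν p g) (q : LabelPat F ν p g) (U : cfgOfRecord F N p.K j) :
    labelChi F N ν M p g A₁ ζ j h q U ≤ 1 := clampW_le_one _

/-- The step kernel is bounded measurable, modulo the (O4) measurability of the label weights. [folklore] -/
theorem labelChi_good
    (hω : ∀ (k : ℕ) (s : SeqOfRecord F ν M g p.K k) (t : LbOfRecord F ν p g k),
      Measurable fun z : cfgOfRecord F N p.K (k + 1) × cfgOfRecord F N p.K k => ωOfRecord F N ν M p g k A₁ ζ s t z.2 z.1)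
    (j : ℕ) (h : Fin j → LabelPat F ν p g) (q : LabelPat F ν p g) :
    (bddMeas (cfgOfRecord F N p.K j)).Gd (labelChi F N ν M p g A₁ ζ j h q) := by
  refine ⟨?_, 1, fun U => abs_clampW_le_one _⟩
  -- elaborate WITHOUT the expected type first (an early unification against it unfolds `ωOfRecord` and times out)
  have hm := (hω j (seqOfHist F ν M p g j h) (labelAt F ν p g j q)).fun_comp (measurable_graphMap (avOfRecord_measurable F N p.K j))
  have hm' := measurable_clampW.fun_comp hm
  exact hm'

/-- **`hρ₀`**: the initial density of record `ρ₀ = e^{−E}·e^{−g₀⁻²A}` is bounded measurable (`0 < ρ₀ ≤ e^{−E}`). [folklore] -/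
theorem rhoZeroOfRecord_good (K : ℕ) (g₀ E : ℝ) : (bddMeas (cfgOfRecord F N K 0)).Gd (rhoZeroOfRecord F N K g₀ E) := by
  refine ⟨(Missing.measurable_boltzmann RegularGaugeGroup.measurable_reTr (F.P K) (g₀⁻¹ ^ 2)).const_mul _, Real.exp (-E), fun U => ?_⟩
  show |Real.exp (-E) * Missing.boltzmann (F.P K) (g₀⁻¹ ^ 2) U| ≤ Real.exp (-E)
  rw [abs_mul, abs_of_pos (Real.exp_pos _), abs_of_pos (Missing.boltzmann_pos (F.P K) _ U)]
  exact mul_le_of_le_one_right (Real.exp_pos _).le (Missing.boltzmann_le_one (F.P K) (sq_nonneg _) U)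

/-- **`hint`**: every history term of a bounded measurable initial density is integrable at its level. [folklore] -/
theorem integrable_eterm {ρ₀ : cfgOfRecord F N p.K 0 → ℝ} (hρ : (bddMeas (cfgOfRecord F N p.K 0)).Gd ρ₀) (j : ℕ)
    (h : Fin j → LabelPat F ν p g) :
    Integrable ((labelTowerOfRecord F N ν M p g A₁ ζ).eterm ρ₀ j h) (lawOfRecord F N p.K j) :=
  integrable_of_bddMeas _ ((labelTowerOfRecord F N ν M p g A₁ ζ).eterm_good hρ j h)

/-- **`hintχ`**: every `labelChi`-weighted history term is integrable, modulo the (O4) measurability. [folklore] -/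
theorem integrable_labelChi_mul_eterm
    (hω : ∀ (k : ℕ) (s : SeqOfRecord F ν M g p.K k) (t : LbOfRecord F ν p g k),
      Measurable fun z : cfgOfRecord F N p.K (k + 1) × cfgOfRecord F N p.K k => ωOfRecord F N ν M p g k A₁ ζ s t z.2 z.1)
    {ρ₀ : cfgOfRecord F N p.K 0 → ℝ} (hρ : (bddMeas (cfgOfRecord F N p.K 0)).Gd ρ₀) (j : ℕ) (h : Fin j → LabelPat F ν p g)
    (q : LabelPat F ν p g) :
    Integrable (fun U => labelChi F N ν M p g A₁ ζ j h q U * (labelTowerOfRecord F N ν M p g A₁ ζ).eterm ρ₀ j h U)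
      (lawOfRecord F N p.K j) :=
  integrable_of_bddMeas _ ((bddMeas _).mul (labelChi_good F N ν M p g hω j h q) ((labelTowerOfRecord F N ν M p g A₁ ζ).eterm_good hρ j h))

/-- **`hint′`**: every one-step image of a history term is integrable at the next level. [folklore] -/
theorem integrable_op_eterm {ρ₀ : cfgOfRecord F N p.K 0 → ℝ} (hρ : (bddMeas (cfgOfRecord F N p.K 0)).Gd ρ₀) (j : ℕ)
    (h : Fin j → LabelPat F ν p g) (q : LabelPat F ν p g) :
    Integrable (((labelTowerOfRecord F N ν M p g A₁ ζ).op j h q).T ((labelTowerOfRecord F N ν M p g A₁ ζ).eterm ρ₀ j h))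
      (lawOfRecord F N p.K (j + 1)) :=
  integrable_of_bddMeas _ (((labelTowerOfRecord F N ν M p g A₁ ζ).op j h q).map_good
    ((labelTowerOfRecord F N ν M p g A₁ ζ).eterm_good hρ j h))

end Record

end Summit.QuantumFields.YangMills.BalabanUVNodes.N20LCSLabelTower

end
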